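import Summits.QuantumFields.BalabanUV.T4Continuum.Support.NE7EnergyBlockLandauClassPoincare
import Summits.QuantumFields.BalabanUV.T4Continuum.Support.NE7ConvOneStepSU3
import HarnessLib

/-!
# NE7EnergyBlockLandauClassPoincareSU3 — gen 99's `classSlicePoincare_energyBlockLandau_SU2` RE-ISSUED FOR SU(3)∕U(3): the Poincaré inequality of the corner-free energy block-Landau slice
# `𝒯_E(W)` on the whole small-field class `sfClass 4 2 N ε` at `card n = 3`, `d = 4`, `L = 2`, every level, every torus, `0 < ε ≤ 10⁻⁵³`, constant `12·CPLine(4,2,3,10⁻¹⁷,10⁻⁵³)`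

Cell `pub-balaban`, rung (B)+1 sub-cell t4, lineage `b2b-balaban-t4-ne7-p1`, generation 105 (CRUX PROVER NE7 #1 = OWNER of BINDER row NE7).  Memo `t4/b2b-balaban-t4-ne7-p1-g105/ROAD-G105.md` §8.
WHY.  The only gauge-group-specific input of this generation's T-E_w♯ assembly is the class slice-Poincaré inequality for `𝒯_E`; gen 99 proved it at `card n = 2`; the SU(3) class Poincaré for
row NE3's `T_♮` exists since gen 67 (`NE7ConvOneStepSU3.classSlicePoincare_SU3`, numerics `NE3ClassSlicePoincare.lines_d4_L2_c3`).  THIS FILE is gen 99's proof VERBATIM with `card n = 3`: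
`classSlicePoincare_SU3` in place of `classSlicePoincare_SU2'`, the Ξ-line and the bound `CPLine 4 2 3 … ≤ 2776·10¹⁴` of `lines_d4_L2_c3`, the absorption line `32·3·16·2776·10¹⁴·10⁻¹⁰⁶ ≤ ½`,
and the transfer `NE7EnergyBlockLandauPoincare.slicePoincare_energyBlockLandauW_of_frameFree`.
WHAT ([folklore]; 0 def, 0 sorry).  **`classSlicePoincare_energyBlockLandau_SU3`**: `card n = 3 → ∀ N ≥ 1, 0 < ε ≤ 10⁻⁵³, ∀ j W, W ∈ sfClass 4 2 N ε (j+1) →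
SlicePoincare 2 (j+1) W (energyBlockLandauW 2 N (j+1) W) (12·CPLine 4 2 3 10⁻¹⁷ 10⁻⁵³) (periodBox (N·2^{j+1}))`.
HONEST FRAMING (page 1): composition of landed kernel theorems; nothing of Bałaban's asserted; NOT T-E_w♯ at SU(3) (next file), NOT NE3∕NE7; spine count unchanged; finite T⁴ rung (B)+1 — NOT infinite
volume, NOT mass gap, NOT BetaPertH, NOT Clay (continuum YM on T⁴ ⇐ BetaPertH ∧ nine spine estimates).
-/

set_option autoImplicit false

namespace Summit.QuantumFields.BalabanUV.T4Continuum.NE7EnergyBlockLandauClassPoincareSU3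

open Literature.MathematicalPhysics.QuantumFieldTheory.Balaban1983to89
open B7Prop1Explicit B7Prop2Explicit
open T4AveragingDeficitWall (IsUnitaryCfg SmallField Plane)
open T4AveragingDeficitWallBoundary (IsPeriodicCfg periodBox)
open AveragingDeficitMultiLevelPrep (LevelSmall tower)
open NE3SlicePoincareBudgetLine (CPLine)
open NE3SlicePoincareShape (SlicePoincare)
open NE3FrameFreeSliceW (frameFreeBlockLandauW)
open NE3ClassSlicePoincare (lines_d4_L2_c2 lines_d4_L2_c3 xi_of_line)
open NE3ClassRadiusFamily (CPLine_nonneg CPLine_nonneg_d4_L2)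
open NE7ConvOneStepSU3 (classSlicePoincare_SU3)
open NE7ConvOneStepSU2 (levelSmall_all_d4_L2)
open NE7SlicePoincareTASU2 (card_plane_four_le)
open NE7CornerSpikeTopDictionary (natCast_tower_eq_pow_mul)
open NE7MeanZeroGaugeSliceW (energyBlockLandauW)
open NE7EnergyBlockLandauPoincare (slicePoincare_energyBlockLandauW_of_frameFree)
open MinimalActionRate (sfClass)

noncomputable section

variable {n : Type*} [Fintype n] [DecidableEq n]

/-- **SLICE POINCARÉ FOR `𝒯_E(W)` ON THE WHOLE SU(3)∕U(3) CLASS AT `d = 4`, `L = 2`** (every `N ≥ 1`, every `0 < ε ≤ 10⁻⁵³`, every level `j+1`, every `W ∈ sfClass 4 2 N ε (j+1)`):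
`SlicePoincare 2 (j+1) W (energyBlockLandauW 2 N (j+1) W) (12·CPLine 4 2 3 10⁻¹⁷ 10⁻⁵³) (periodBox (N·2^{j+1}))`. [folklore] -/
theorem classSlicePoincare_energyBlockLandau_SU3 [Nonempty n] (hn : Fintype.card n = 3) {N : ℕ} [NeZero N] (hN : 1 ≤ N) {ε : ℝ} (hε : 0 < ε)
    (hε' : ε ≤ 1 / 10 ^ 53) :
    ∀ j : ℕ, ∀ W : Site 4 → Fin 4 → (Matrix n n ℂ)ˣ, W ∈ sfClass 4 2 N ε (j + 1) →
      SlicePoincare 2 (j + 1) W (energyBlockLandauW (d := 4) (n := n) 2 N (j + 1) W) (12 * CPLine 4 2 3 (1 / 10 ^ 17) (1 / 10 ^ 53))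
        (periodBox (d := 4) (N * 2 ^ (j + 1))) := by
  intro j W hW
  obtain ⟨hWu, hWP, hWx⟩ := hW
  have htower : tower 2 N (j + 1) = 2 ^ (j + 1) * N := by exact_mod_cast natCast_tower_eq_pow_mul 2 N (j + 1)
  have hNM : N * 2 ^ (j + 1) = tower 2 N (j + 1) := by rw [htower, Nat.mul_comm]
  -- the class data in the transfer theorem's format
  set x : ℝ := ε / (((2 : ℕ) : ℝ) ^ (j + 1)) ^ 2 with hxdef
  have hx : 0 ≤ x := by rw [hxdef]; positivity
  have hs : LevelSmall 4 2 j x := levelSmall_all_d4_L2 hε.le (hε'.trans (by norm_num)) j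
  have hWP' : IsPeriodicCfg W ((tower 2 N (j + 1) : ℕ) : ℤ) := by rw [← hNM]; exact hWP
  have hMx : (((2 : ℕ) : ℝ) ^ (j + 1)) ^ 2 * x = ε := by
    rw [hxdef]; field_simp
  -- row NE3-R2's class Poincaré on `T_♮`
  have hP := classSlicePoincare_SU3 (n := n) hn hN hε hε' j W ⟨hWu, hWP, hWx⟩
  rw [hNM] at hP
  -- K6-Ξ's line at `θ = 10⁻⁵³`
  obtain ⟨-, -, hΞ, hCP⟩ := lines_d4_L2_c3
  have hline : 8 * ((4 : ℕ) : ℝ) * ((((4 : ℕ) : ℝ) - 1) * (1 / 10 ^ 53)) ^ 2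
      + 2 * (((Fintype.card n : ℕ) : ℝ) * ((4 * ((4 : ℕ) : ℝ) ^ 2 + 272 * ((4 : ℕ) : ℝ) * ((((4 : ℕ) : ℝ) + 1) * (((4 : ℕ) : ℝ) + 4))) * (1 / 10 ^ 53)) ^ 2)
        ≤ 1 / 2 := by
    rw [hn]; exact hΞ
  have hK6 := xi_of_line (d := 4) (by norm_num) (L := 2) (c := Fintype.card n) (by norm_num) j hx hs (θ := 1 / 10 ^ 53) (by rw [hMx]; exact hε') hline
  have hcard : (Fintype.card n : ℝ) = ((3 : ℕ) : ℝ) := by rw [hn]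
  -- the absorption line
  have hC0 : 0 ≤ CPLine 4 2 3 (1 / 10 ^ 17) (1 / 10 ^ 53) := CPLine_nonneg (by norm_num) (by norm_num) (by norm_num) (by norm_num)
  have hPl := card_plane_four_le
  have hPl0 : (0 : ℝ) ≤ Fintype.card (Plane 4) := Nat.cast_nonneg _
  have habs : 32 * (Fintype.card n : ℝ) * (Fintype.card (Plane 4) : ℝ) * CPLine 4 2 3 (1 / 10 ^ 17) (1 / 10 ^ 53)
      * ((((2 : ℕ) : ℝ) ^ (j + 1)) ^ 2 * x) ^ 2 ≤ 1 / 2 := by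
    rw [hMx, hcard]
    have hε2 : ε ^ 2 ≤ (1 / 10 ^ 53) ^ 2 := pow_le_pow_left₀ hε.le hε' 2
    have hε20 : 0 ≤ ε ^ 2 := sq_nonneg _
    calc 32 * (((3 : ℕ) : ℝ)) * (Fintype.card (Plane 4) : ℝ) * CPLine 4 2 3 (1 / 10 ^ 17) (1 / 10 ^ 53) * ε ^ 2
        ≤ 32 * (((3 : ℕ) : ℝ)) * 16 * (2776 * 10 ^ 14) * (1 / 10 ^ 53) ^ 2 := by
          have h1 : 32 * (((3 : ℕ) : ℝ)) * (Fintype.card (Plane 4) : ℝ) ≤ 32 * (((3 : ℕ) : ℝ)) * 16 := by nlinarith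
          have h2 : 32 * (((3 : ℕ) : ℝ)) * (Fintype.card (Plane 4) : ℝ) * CPLine 4 2 3 (1 / 10 ^ 17) (1 / 10 ^ 53)
              ≤ 32 * (((3 : ℕ) : ℝ)) * 16 * (2776 * 10 ^ 14) :=
            mul_le_mul h1 hCP hC0 (by norm_num)
          exact mul_le_mul h2 hε2 hε20 (by norm_num)
      _ ≤ 1 / 2 := by norm_num
  -- transfer
  have hT := slicePoincare_energyBlockLandauW_of_frameFree (d := 4) (n := n) (N := N) (L := 2) (by norm_num) (by norm_num) j
    hWu hWP' hx hs hWx hK6 hC0 habs hP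
  rw [hNM]
  have e8 : 4 * (Fintype.card n : ℝ) * CPLine 4 2 3 (1 / 10 ^ 17) (1 / 10 ^ 53) = 12 * CPLine 4 2 3 (1 / 10 ^ 17) (1 / 10 ^ 53) := by
    rw [hn]; push_cast; ring
  rw [← e8]
  exact hT

end

end Summit.QuantumFields.BalabanUV.T4Continuum.NE7EnergyBlockLandauClassPoincareSU3
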